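import Summits.ValiantsHypothesis.ValiantsHypothesis.Theorems.LacunarySymmetroidMatrixDescartesDoorA26WallBubblingMixThreeCore

/-!
# Wall bubbling for `DoorA26` — TWO WEYL PAIRS: THE REPAIRED THREE-SCALE RULE, SCALAR ASSEMBLY (cases A/B, the Lorentz–Gram kill)

HONEST FRAMING.  Obligation (W) `stub_weylFaces` of `Cruxes/DoorA26/Lines/wall_bubbling.lean` (crux `DoorA26`, stmt-ValiantsHypothesis-19979; OPEN,
typed, never asserted); W1 seat val-sym-door-p2 g14; third file towards `MixThree26'` (rev 9 of `Lines/wall_bubbling_ConfluentDoor.lean`).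
Everything here is scalar except the two `D`-bounds, which take four SYMMETRIC letters:

* `mixThree_Dsq_le₀` / `mixThree_Dsq_le₁` — at the third scale a mixed degree-1 member alive + the dominant pure class dominated ⇒
  `κ₃·D² ≤ 240Φ⁶εμ₁⁴` (`D = g₀₁g₅₄ − g₀₄g₅₁`, `ε = e^{−|δ₀−δ₁|S₃}`; W1 `pureClass_suppressed` + `mixedBlock_det_sq_le`);
* `mixThree_kill_same` / `mixThree_kill_cross` — the lower bounds of W1 `mixThree_core_same` / `mixThree_core_cross` against that `D`-bound are
  absurd once `122880·Φ¹⁸·ε < κ₁⁴κ₂²κ₃³`;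
* `mixThree_caseA` (the first-scale alive member is `(0,4)`), `mixThree_scalar` (both cases; case B = case A relabelled `0 ↔ 1`, `5 ↔ 4`).

Registers unchanged; (W), `MixThree26'`, `DoorA26` 19979, 18050 OPEN; nothing on VP ≠ VNP.  Def-free.  `--supports stmt-ValiantsHypothesis-19979 --as helper`.
-/

-- `Summit.ValiantsHypothesis.ValiantsHypothesis.…` repeats a component by the D-0017 layout
-- (single-conjunct summit), which the `dupNamespace` linter flags; the name is mandated.
set_option linter.dupNamespace false

namespace Summit.ValiantsHypothesis.ValiantsHypothesis.Theorems.LacunarySymmetroidMatrixDescartes.WallBubbling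

open Finset Filter Topology
open Bubbling (polar polar_apply polar_comm polar_smul_left_right)
open scoped BigOperators

/-! ## 1. The `D`-bound from the dominant pure class -/

/-- **`κ₃D² ≤ 240Φ⁶εμ₁⁴` when the class `2δ₀` dominates** (`δ₁ < δ₀`, `E₁ = εE₀` at the third scale). [this work] -/
theorem mixThree_Dsq_le₀ (V₀ V₅ V₁ V₄ : Matrix (Fin 2) (Fin 2) ℝ) (h₀ : V₀.IsSymm) (h₅ : V₅.IsSymm) (h₁ : V₁.IsSymm) (h₄ : V₄.IsSymm)
    {κ₃ μ₁ μ₃ E₀ ε e e' Λ Λ' Φ : ℝ} (hκ₃ : 0 < κ₃) (hμ₁ : 0 < μ₁) (hE₀ : 0 < E₀) (hε : 0 < ε) (he : 0 < e) (he' : 0 < e')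
    (b11 : |polar V₁ V₁| ≤ μ₁) (b14 : |polar V₁ V₄| ≤ μ₁) (b44 : |polar V₄ V₄| ≤ μ₁) (b01 : |polar V₀ V₁| ≤ μ₁)
    (b04 : |polar V₀ V₄| ≤ μ₁) (b51 : |polar V₅ V₁| ≤ μ₁) (b54 : |polar V₅ V₄| ≤ μ₁)
    (halive : κ₃ * μ₃ ≤ E₀ * (ε * E₀) * e' * |polar V₀ V₄ + Λ * polar V₅ V₄| ∨
      κ₃ * μ₃ ≤ E₀ * (ε * E₀) * e * |polar V₅ V₁ + Λ' * polar V₅ V₄|)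
    (hd55 : E₀ * E₀ * (e * e) * |polar V₅ V₅| ≤ μ₃) (hd05 : E₀ * E₀ * e * |polar V₀ V₅ + Λ * polar V₅ V₅| ≤ μ₃)
    (hd00 : E₀ * E₀ * |polar V₀ V₀ + 2 * Λ * polar V₀ V₅ + Λ * Λ * polar V₅ V₅| ≤ μ₃)
    (hΦ : 1 + |Λ| + |Λ'| + e + e' + e⁻¹ + e'⁻¹ ≤ Φ) (hsmall : 12 * Φ ^ 6 * ε ≤ κ₃) :
    κ₃ * (polar V₀ V₁ * polar V₅ V₄ - polar V₀ V₄ * polar V₅ V₁) ^ 2 ≤ 240 * Φ ^ 6 * ε * μ₁ ^ 4 := by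
  obtain ⟨s55, s05, s00⟩ := pureClass_suppressed hκ₃ hμ₁.le hE₀ hε he he' b04 b54 b51 halive hd55 hd05 hd00 hΦ
  set Z : ℝ := 12 * Φ ^ 6 * ε * μ₁ with hZ
  have hZ0 : 0 ≤ Z := by
    have : 0 ≤ 12 * Φ ^ 6 * ε := by
      have hΦ1 : 1 ≤ Φ := by linarith [abs_nonneg Λ, abs_nonneg Λ', inv_pos.mpr he, inv_pos.mpr he']
      positivity
    rw [hZ]; positivity
  have c55 : |polar V₅ V₅| ≤ Z / κ₃ := by rw [le_div_iff₀ hκ₃, mul_comm]; exact s55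
  have c05 : |polar V₀ V₅| ≤ Z / κ₃ := by rw [le_div_iff₀ hκ₃, mul_comm]; exact s05
  have c00 : |polar V₀ V₀| ≤ Z / κ₃ := by rw [le_div_iff₀ hκ₃, mul_comm]; exact s00
  have hEμ : Z / κ₃ ≤ μ₁ := by
    rw [div_le_iff₀ hκ₃, hZ]
    nlinarith [mul_le_mul_of_nonneg_right hsmall hμ₁.le]
  have hG := mixedBlock_det_sq_le V₀ V₅ V₁ V₄ h₀ h₅ h₁ h₄ c00 c05 c55 b11 b14 b44 b01 b04 b51 b54 hEμ le_rfl
  have hZκ : κ₃ * (Z / κ₃) = Z := mul_div_cancel₀ Z hκ₃.ne'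
  calc κ₃ * (polar V₀ V₁ * polar V₅ V₄ - polar V₀ V₄ * polar V₅ V₁) ^ 2 ≤ κ₃ * (20 * (Z / κ₃) * μ₁ * μ₁ ^ 2) :=
        mul_le_mul_of_nonneg_left hG hκ₃.le
    _ = 20 * (κ₃ * (Z / κ₃)) * μ₁ * μ₁ ^ 2 := by ring
    _ = 240 * Φ ^ 6 * ε * μ₁ ^ 4 := by rw [hZκ, hZ]; ring

/-- **`κ₃D² ≤ 240Φ⁶εμ₁⁴` when the class `2δ₁` dominates** (`δ₀ < δ₁`, `E₀ = εE₁`): the mirror instance. [this work] -/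
theorem mixThree_Dsq_le₁ (V₀ V₅ V₁ V₄ : Matrix (Fin 2) (Fin 2) ℝ) (h₀ : V₀.IsSymm) (h₅ : V₅.IsSymm) (h₁ : V₁.IsSymm) (h₄ : V₄.IsSymm)
    {κ₃ μ₁ μ₃ E₁ ε e e' Λ Λ' Φ : ℝ} (hκ₃ : 0 < κ₃) (hμ₁ : 0 < μ₁) (hE₁ : 0 < E₁) (hε : 0 < ε) (he : 0 < e) (he' : 0 < e')
    (b00 : |polar V₀ V₀| ≤ μ₁) (b05 : |polar V₀ V₅| ≤ μ₁) (b55 : |polar V₅ V₅| ≤ μ₁) (b01 : |polar V₀ V₁| ≤ μ₁)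
    (b04 : |polar V₀ V₄| ≤ μ₁) (b51 : |polar V₅ V₁| ≤ μ₁) (b54 : |polar V₅ V₄| ≤ μ₁)
    (halive : κ₃ * μ₃ ≤ (ε * E₁) * E₁ * e' * |polar V₀ V₄ + Λ * polar V₅ V₄| ∨
      κ₃ * μ₃ ≤ (ε * E₁) * E₁ * e * |polar V₅ V₁ + Λ' * polar V₅ V₄|)
    (hd44 : E₁ * E₁ * (e' * e') * |polar V₄ V₄| ≤ μ₃) (hd14 : E₁ * E₁ * e' * |polar V₁ V₄ + Λ' * polar V₄ V₄| ≤ μ₃)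
    (hd11 : E₁ * E₁ * |polar V₁ V₁ + 2 * Λ' * polar V₁ V₄ + Λ' * Λ' * polar V₄ V₄| ≤ μ₃)
    (hΦ : 1 + |Λ| + |Λ'| + e + e' + e⁻¹ + e'⁻¹ ≤ Φ) (hsmall : 12 * Φ ^ 6 * ε ≤ κ₃) :
    κ₃ * (polar V₀ V₁ * polar V₅ V₄ - polar V₀ V₄ * polar V₅ V₁) ^ 2 ≤ 240 * Φ ^ 6 * ε * μ₁ ^ 4 := by
  have halive' : κ₃ * μ₃ ≤ E₁ * (ε * E₁) * e * |polar V₅ V₁ + Λ' * polar V₅ V₄| ∨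
      κ₃ * μ₃ ≤ E₁ * (ε * E₁) * e' * |polar V₀ V₄ + Λ * polar V₅ V₄| := by
    rcases halive with h | h
    · right; rw [mul_comm (ε * E₁) E₁] at h; exact h
    · left; rw [mul_comm (ε * E₁) E₁] at h; exact h
  have hΦ' : 1 + |Λ'| + |Λ| + e' + e + e'⁻¹ + e⁻¹ ≤ Φ := by linarith
  obtain ⟨s44, s14, s11⟩ := pureClass_suppressed hκ₃ hμ₁.le hE₁ hε he' he b51 b54 b04 halive' hd44 hd14 hd11 hΦ'
  set Z : ℝ := 12 * Φ ^ 6 * ε * μ₁ with hZ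
  have c44 : |polar V₄ V₄| ≤ Z / κ₃ := by rw [le_div_iff₀ hκ₃, mul_comm]; exact s44
  have c14 : |polar V₁ V₄| ≤ Z / κ₃ := by rw [le_div_iff₀ hκ₃, mul_comm]; exact s14
  have c11 : |polar V₁ V₁| ≤ Z / κ₃ := by rw [le_div_iff₀ hκ₃, mul_comm]; exact s11
  have hBμ : Z / κ₃ ≤ μ₁ := by
    rw [div_le_iff₀ hκ₃, hZ]
    nlinarith [mul_le_mul_of_nonneg_right hsmall hμ₁.le]
  have hG := mixedBlock_det_sq_le V₀ V₅ V₁ V₄ h₀ h₅ h₁ h₄ b00 b05 b55 c11 c14 c44 b01 b04 b51 b54 le_rfl hBμ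
  have hZκ : κ₃ * (Z / κ₃) = Z := mul_div_cancel₀ Z hκ₃.ne'
  calc κ₃ * (polar V₀ V₁ * polar V₅ V₄ - polar V₀ V₄ * polar V₅ V₁) ^ 2 ≤ κ₃ * (20 * μ₁ * (Z / κ₃) * μ₁ ^ 2) :=
        mul_le_mul_of_nonneg_left hG hκ₃.le
    _ = 20 * (κ₃ * (Z / κ₃)) * μ₁ * μ₁ ^ 2 := by ring
    _ = 240 * Φ ^ 6 * ε * μ₁ ^ 4 := by rw [hZκ, hZ]; ring

/-! ## 2. The kills -/

/-- Kill for the «same member twice» lower bound. [this work] -/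
theorem mixThree_kill_same {κ₁ κ κ₃ μ₁ e Λ Φ ε D : ℝ} (hκ₁ : 0 < κ₁) (hκ : 0 < κ) (hκ1 : κ ≤ 1) (hκ₃ : 0 < κ₃) (hμ₁ : 0 < μ₁)
    (he : 0 < e) (hΛΦ : |Λ| ≤ Φ) (heΦ : e⁻¹ ≤ Φ) (heΦ' : e ≤ Φ) (hΦ1 : 1 ≤ Φ)
    (hL : κ * e * κ₁ ^ 2 * μ₁ ^ 2 ≤ |Λ| * (κ * e + |Λ|) * |D|) (hD : κ₃ * D ^ 2 ≤ 240 * Φ ^ 6 * ε * μ₁ ^ 4)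
    (hk : 960 * Φ ^ 12 * ε < κ₃ * κ ^ 2 * κ₁ ^ 4) : False := by
  have hΦpos : 0 < Φ := lt_of_lt_of_le one_pos hΦ1
  have hΛ0 : 0 ≤ |Λ| := abs_nonneg _
  have heΦ1 : 1 ≤ e * Φ := by
    have := mul_le_mul_of_nonneg_left heΦ he.le
    rwa [mul_inv_cancel₀ he.ne'] at this
  -- `|Λ|(κe + |Λ|) ≤ 2Φ²`
  have hc : |Λ| * (κ * e + |Λ|) ≤ 2 * Φ ^ 2 := by
    have : κ * e + |Λ| ≤ 2 * Φ := by nlinarith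
    nlinarith
  -- square: `(κeκ₁²μ₁²)² ≤ (2Φ²)²·D²`
  have hL0 : 0 ≤ κ * e * κ₁ ^ 2 * μ₁ ^ 2 := by positivity
  have h1 : (κ * e * κ₁ ^ 2 * μ₁ ^ 2) ^ 2 ≤ (2 * Φ ^ 2) ^ 2 * D ^ 2 := by
    have t : κ * e * κ₁ ^ 2 * μ₁ ^ 2 ≤ 2 * Φ ^ 2 * |D| := le_trans hL (mul_le_mul_of_nonneg_right hc (abs_nonneg D))
    have t2 := pow_le_pow_left₀ hL0 t 2
    have e1 : (2 * Φ ^ 2 * |D|) ^ 2 = (2 * Φ ^ 2) ^ 2 * D ^ 2 := by rw [mul_pow, sq_abs]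
    rw [e1] at t2
    exact t2
  -- times `κ₃`: `κ₃κ²e²κ₁⁴μ₁⁴ ≤ 4Φ⁴·240Φ⁶εμ₁⁴`
  have h2 : κ₃ * (κ * e * κ₁ ^ 2 * μ₁ ^ 2) ^ 2 ≤ (2 * Φ ^ 2) ^ 2 * (240 * Φ ^ 6 * ε * μ₁ ^ 4) := by
    have := mul_le_mul_of_nonneg_left h1 hκ₃.le
    have t2 := mul_le_mul_of_nonneg_left hD (by positivity : (0:ℝ) ≤ (2 * Φ ^ 2) ^ 2)
    nlinarith
  -- use `(eΦ)² ≥ 1` and divide by `μ₁⁴ > 0`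
  have hμ4 : 0 < μ₁ ^ 4 := by positivity
  have h3 : κ₃ * κ ^ 2 * κ₁ ^ 4 * μ₁ ^ 4 ≤ 960 * Φ ^ 12 * ε * μ₁ ^ 4 := by
    have eΦ2 : 1 ≤ (e * Φ) ^ 2 := one_le_pow₀ heΦ1
    have t : κ₃ * κ ^ 2 * κ₁ ^ 4 * μ₁ ^ 4 ≤ κ₃ * κ ^ 2 * κ₁ ^ 4 * μ₁ ^ 4 * (e * Φ) ^ 2 := by
      have := mul_le_mul_of_nonneg_left eΦ2 (by positivity : (0:ℝ) ≤ κ₃ * κ ^ 2 * κ₁ ^ 4 * μ₁ ^ 4)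
      linarith
    have e1 : κ₃ * κ ^ 2 * κ₁ ^ 4 * μ₁ ^ 4 * (e * Φ) ^ 2 = Φ ^ 2 * (κ₃ * (κ * e * κ₁ ^ 2 * μ₁ ^ 2) ^ 2) := by ring
    have e2 : Φ ^ 2 * ((2 * Φ ^ 2) ^ 2 * (240 * Φ ^ 6 * ε * μ₁ ^ 4)) = 960 * Φ ^ 12 * ε * μ₁ ^ 4 := by ring
    have t2 := mul_le_mul_of_nonneg_left h2 (by positivity : (0:ℝ) ≤ Φ ^ 2)
    linarith
  have h4 : κ₃ * κ ^ 2 * κ₁ ^ 4 ≤ 960 * Φ ^ 12 * ε := le_of_mul_le_mul_right h3 hμ4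
  linarith

/-- Kill for the «other member at both later scales» lower bound. [this work] -/
theorem mixThree_kill_cross {κ₁ κ₂ κ₃ μ₁ e₂ e₂' e₃ e₃' Λ₂ Λ₃ Λ₂' Λ₃' Φ ε D : ℝ} (hκ₁ : 0 < κ₁) (hκ₂ : 0 < κ₂) (hκ₃ : 0 < κ₃)
    (hμ₁ : 0 < μ₁) (he₂ : 0 < e₂) (he₂' : 0 < e₂') (he₃ : 0 < e₃) (he₃' : 0 < e₃') (hΦ1 : 1 ≤ Φ)
    (hΛ₂ : |Λ₂| ≤ Φ) (hΛ₃ : |Λ₃| ≤ Φ) (hΛ₂' : |Λ₂'| ≤ Φ) (hΛ₃' : |Λ₃'| ≤ Φ) (he₂Φ : e₂ ≤ Φ) (he₃Φ : e₃ ≤ Φ)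
    (hi₂ : e₂⁻¹ ≤ Φ) (hi₂' : e₂'⁻¹ ≤ Φ) (hi₃' : e₃'⁻¹ ≤ Φ)
    (hX : κ₁ ^ 2 * κ₂ * κ₃ * μ₁ ^ 2 * (e₂ * (e₂' * e₃')) < |Λ₃' - Λ₂'| * |D| * ((e₂ + |Λ₂|) * (e₃ + |Λ₃|)))
    (hD : κ₃ * D ^ 2 ≤ 240 * Φ ^ 6 * ε * μ₁ ^ 4) (hk : 15360 * Φ ^ 18 * ε ≤ κ₁ ^ 4 * κ₂ ^ 2 * κ₃ ^ 3) : False := by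
  have hΦpos : 0 < Φ := lt_of_lt_of_le one_pos hΦ1
  have inv1 : ∀ {x : ℝ}, 0 < x → x⁻¹ ≤ Φ → 1 ≤ x * Φ := by
    intro x hx h
    have := mul_le_mul_of_nonneg_left h hx.le
    rwa [mul_inv_cancel₀ hx.ne'] at this
  have p₂ := inv1 he₂ hi₂
  have p₂' := inv1 he₂' hi₂'
  have p₃' := inv1 he₃' hi₃'
  -- RHS ≤ 8Φ³|D|
  have hD0 : 0 ≤ |D| := abs_nonneg _
  have r1 : |Λ₃' - Λ₂'| ≤ 2 * Φ := by have := abs_sub Λ₃' Λ₂'; linarith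
  have r2 : (e₂ + |Λ₂|) * (e₃ + |Λ₃|) ≤ (2 * Φ) * (2 * Φ) :=
    mul_le_mul (by linarith) (by linarith) (by positivity) (by positivity)
  have rhs : |Λ₃' - Λ₂'| * |D| * ((e₂ + |Λ₂|) * (e₃ + |Λ₃|)) ≤ 8 * Φ ^ 3 * |D| := by
    have t1 : |Λ₃' - Λ₂'| * |D| ≤ 2 * Φ * |D| := mul_le_mul_of_nonneg_right r1 hD0
    have t2 := mul_le_mul t1 r2 (by positivity) (by positivity)
    nlinarith
  -- LHS ≥ κ₁²κ₂κ₃μ₁²/Φ³, i.e. `κ₁²κ₂κ₃μ₁² ≤ LHS·Φ³`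
  set P : ℝ := κ₁ ^ 2 * κ₂ * κ₃ * μ₁ ^ 2 with hP
  have hP0 : 0 < P := by rw [hP]; positivity
  have lhs : P ≤ P * (e₂ * (e₂' * e₃')) * Φ ^ 3 := by
    have prod : 1 ≤ (e₂ * Φ) * ((e₂' * Φ) * (e₃' * Φ)) := by
      have := one_le_mul_of_one_le_of_one_le p₂ (one_le_mul_of_one_le_of_one_le p₂' p₃')
      exact this
    have := mul_le_mul_of_nonneg_left prod hP0.le
    have e1 : P * ((e₂ * Φ) * ((e₂' * Φ) * (e₃' * Φ))) = P * (e₂ * (e₂' * e₃')) * Φ ^ 3 := by ring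
    linarith
  -- hence `P < 8Φ⁶|D|`
  have h1 : P < 8 * Φ ^ 6 * |D| := by
    have t : P * (e₂ * (e₂' * e₃')) * Φ ^ 3 < 8 * Φ ^ 3 * |D| * Φ ^ 3 :=
      mul_lt_mul_of_pos_right (lt_of_lt_of_le hX rhs) (by positivity)
    have e1 : 8 * Φ ^ 3 * |D| * Φ ^ 3 = 8 * Φ ^ 6 * |D| := by ring
    linarith
  -- square and multiply by `κ₃`
  have h2 : P ^ 2 < (8 * Φ ^ 6) ^ 2 * D ^ 2 := by
    have t := pow_lt_pow_left₀ h1 hP0.le two_ne_zero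
    have e1 : (8 * Φ ^ 6 * |D|) ^ 2 = (8 * Φ ^ 6) ^ 2 * D ^ 2 := by rw [mul_pow, sq_abs]
    rw [e1] at t; exact t
  have h3 : κ₃ * P ^ 2 < (8 * Φ ^ 6) ^ 2 * (240 * Φ ^ 6 * ε * μ₁ ^ 4) := by
    have t1 := mul_lt_mul_of_pos_left h2 hκ₃
    have t2 := mul_le_mul_of_nonneg_left hD (by positivity : (0:ℝ) ≤ (8 * Φ ^ 6) ^ 2)
    nlinarith
  -- `κ₃P² = κ₁⁴κ₂²κ₃³μ₁⁴`; divide by `μ₁⁴`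
  have hμ4 : 0 < μ₁ ^ 4 := by positivity
  have h4 : (κ₁ ^ 4 * κ₂ ^ 2 * κ₃ ^ 3) * μ₁ ^ 4 < (15360 * Φ ^ 18 * ε) * μ₁ ^ 4 := by
    have e1 : κ₃ * P ^ 2 = (κ₁ ^ 4 * κ₂ ^ 2 * κ₃ ^ 3) * μ₁ ^ 4 := by rw [hP]; ring
    have e2 : (8 * Φ ^ 6) ^ 2 * (240 * Φ ^ 6 * ε * μ₁ ^ 4) = (15360 * Φ ^ 18 * ε) * μ₁ ^ 4 := by ring
    rw [← e1, ← e2]; exact h3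
  have h5 : κ₁ ^ 4 * κ₂ ^ 2 * κ₃ ^ 3 < 15360 * Φ ^ 18 * ε := lt_of_mul_lt_mul_right h4 hμ4.le
  linarith

/-! ## 3. Scalar case analysis -/

/-- Stripping a common positive weight: `κ·(c·a) ≤ κμ` and `κμ ≤ c·b` give `κa ≤ b`. [folklore] -/
theorem strip_weight {κ μ c a b : ℝ} (hκ : 0 ≤ κ) (hc : 0 < c) (hd : c * a ≤ μ) (ha : κ * μ ≤ c * b) : κ * a ≤ b := by
  have t : c * (κ * a) ≤ c * b := by nlinarith [mul_le_mul_of_nonneg_left hd hκ]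
  exact le_of_mul_le_mul_left t hc

/-- **CASE A of the repaired three-scale rule** (first-scale alive member `(0,4)`), scalar form; see the module docstring. [this work] -/
theorem mixThree_caseA {κ₁ κ₂ κ₃ μ₁ μ₂ μ₃ A₂ A₃ e₂ e₂' e₃ e₃' eL Λ₂ Λ₂' Λ₃ Λ₃' ΛL g₀₁ g₀₄ g₅₁ g₅₄ Φ ε : ℝ}
    (hκ₁ : 0 < κ₁) (hκ₂ : 0 < κ₂) (hκ₃ : 0 < κ₃) (hκ₂1 : κ₂ ≤ 1) (hκ₃1 : κ₃ ≤ 1) (hμ₁ : 0 < μ₁)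
    (hA₂ : 0 < A₂) (hA₃ : 0 < A₃) (he₂ : 0 < e₂) (he₂' : 0 < e₂') (he₃ : 0 < e₃) (he₃' : 0 < e₃') (hε : 0 < ε)
    (h04 : κ₁ * μ₁ ≤ |g₀₄|) (b01 : |g₀₁| ≤ μ₁)
    (al₂ : κ₂ * μ₂ ≤ A₂ * e₂' * |g₀₄ + Λ₂ * g₅₄| ∨ κ₂ * μ₂ ≤ A₂ * e₂ * |g₅₁ + Λ₂' * g₅₄|)
    (d01₂ : A₂ * |g₀₁ + Λ₂' * g₀₄ + Λ₂ * g₅₁ + Λ₂ * Λ₂' * g₅₄| ≤ μ₂) (d04₂ : A₂ * e₂' * |g₀₄ + Λ₂ * g₅₄| ≤ μ₂)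
    (d54₂ : A₂ * (e₂ * e₂') * |g₅₄| ≤ μ₂)
    (al₃ : κ₃ * μ₃ ≤ A₃ * e₃' * |g₀₄ + Λ₃ * g₅₄| ∨ κ₃ * μ₃ ≤ A₃ * e₃ * |g₅₁ + Λ₃' * g₅₄|)
    (d01₃ : A₃ * |g₀₁ + Λ₃' * g₀₄ + Λ₃ * g₅₁ + Λ₃ * Λ₃' * g₅₄| ≤ μ₃) (d04₃ : A₃ * e₃' * |g₀₄ + Λ₃ * g₅₄| ≤ μ₃)
    (d54₃ : A₃ * (e₃ * e₃') * |g₅₄| ≤ μ₃)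
    (hD : κ₃ * (g₀₁ * g₅₄ - g₀₄ * g₅₁) ^ 2 ≤ 240 * Φ ^ 6 * ε * μ₁ ^ 4)
    (hΦ₂ : 1 + |Λ₂| + |Λ₂'| + e₂ + e₂' + e₂⁻¹ + e₂'⁻¹ ≤ Φ) (hΦ₃ : 1 + |Λ₃| + |Λ₃'| + e₃ + e₃' + e₃⁻¹ + e₃'⁻¹ ≤ Φ)
    (gΛ₂' : 1 / κ₂ * e₂' + (1 / κ₁ + 1) < |Λ₂'|) (gΛ₃' : 1 / κ₃ * e₃' + (1 / κ₁ + 1) < |Λ₃'|)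
    (hshift : Λ₃ - Λ₂ = e₂ * ΛL) (he₃L : e₃ = e₂ * eL) (gΛL : 1 / κ₃ * eL + (1 / κ₂ + 1) < |ΛL|)
    (hkill : 122880 * Φ ^ 18 * ε < κ₁ ^ 4 * κ₂ ^ 2 * κ₃ ^ 3) : False := by
  have hΛ₂0 : 0 ≤ |Λ₂| := abs_nonneg _
  have hΛ₃0 : 0 ≤ |Λ₃| := abs_nonneg _
  have hΛ₂'0 : 0 ≤ |Λ₂'| := abs_nonneg _
  have hΛ₃'0 : 0 ≤ |Λ₃'| := abs_nonneg _
  have i2 : 0 < e₂⁻¹ := inv_pos.mpr he₂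
  have i2' : 0 < e₂'⁻¹ := inv_pos.mpr he₂'
  have i3 : 0 < e₃⁻¹ := inv_pos.mpr he₃
  have i3' : 0 < e₃'⁻¹ := inv_pos.mpr he₃'
  have hΦ1 : 1 ≤ Φ := by linarith [abs_nonneg Λ₂']
  have hΦpos : 0 < Φ := lt_of_lt_of_le one_pos hΦ1
  -- the kill inequality in the two forms the kills want (uses `κ₂, κ₃ ≤ 1`, `Φ ≥ 1`)
  have hΦ1218 : Φ ^ 12 ≤ Φ ^ 18 := pow_le_pow_right₀ hΦ1 (by norm_num)
  have hk2 : κ₂ ^ 2 ≤ 1 := pow_le_one₀ hκ₂.le hκ₂1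
  have hk3' : κ₃ ^ 2 ≤ 1 := pow_le_one₀ hκ₃.le hκ₃1
  have hk3 : κ₃ ^ 3 ≤ κ₃ := by
    have := mul_le_mul_of_nonneg_left hk3' hκ₃.le
    calc κ₃ ^ 3 = κ₃ * κ₃ ^ 2 := by ring
      _ ≤ κ₃ * 1 := this
      _ = κ₃ := mul_one κ₃
  have hPε : 0 ≤ Φ ^ 12 * ε := by positivity
  have t12 : Φ ^ 12 * ε ≤ Φ ^ 18 * ε := mul_le_mul_of_nonneg_right hΦ1218 hε.le
  have t960 : 960 * Φ ^ 12 * ε ≤ 122880 * Φ ^ 18 * ε := by linarith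
  have ks₂ : 960 * Φ ^ 12 * ε < κ₃ * κ₂ ^ 2 * κ₁ ^ 4 := by
    have t2 : (κ₁ ^ 4 * κ₂ ^ 2) * κ₃ ^ 3 ≤ (κ₁ ^ 4 * κ₂ ^ 2) * κ₃ :=
      mul_le_mul_of_nonneg_left hk3 (by positivity : (0:ℝ) ≤ κ₁ ^ 4 * κ₂ ^ 2)
    linarith
  have ks₃ : 960 * Φ ^ 12 * ε < κ₃ * κ₃ ^ 2 * κ₁ ^ 4 := by
    have t2 : (κ₁ ^ 4 * κ₃ ^ 3) * κ₂ ^ 2 ≤ (κ₁ ^ 4 * κ₃ ^ 3) * 1 :=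
      mul_le_mul_of_nonneg_left hk2 (by positivity : (0:ℝ) ≤ κ₁ ^ 4 * κ₃ ^ 3)
    linarith
  have hPε18 : 0 ≤ Φ ^ 18 * ε := by positivity
  have kc : 15360 * Φ ^ 18 * ε ≤ κ₁ ^ 4 * κ₂ ^ 2 * κ₃ ^ 3 := by linarith
  -- (0,4) alive again at scale `i`: contradiction
  have same : ∀ {κ μ A e e' Λ Λ' : ℝ}, 0 < κ → κ ≤ 1 → 0 < A → 0 < e → 0 < e' →
      κ * μ ≤ A * e' * |g₀₄ + Λ * g₅₄| → A * |g₀₁ + Λ' * g₀₄ + Λ * g₅₁ + Λ * Λ' * g₅₄| ≤ μ → A * (e * e') * |g₅₄| ≤ μ →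
      1 + |Λ| + |Λ'| + e + e' + e⁻¹ + e'⁻¹ ≤ Φ → 1 / κ * e' + (1 / κ₁ + 1) < |Λ'| → 960 * Φ ^ 12 * ε < κ₃ * κ ^ 2 * κ₁ ^ 4 → False := by
    intro κ μ A e e' Λ Λ' hκ hκ1 hA he he' al d01 d54 hΦ gΛ' ks
    -- strip the weights `A e'`
    have hv01 : κ * |(g₀₁ + Λ * g₅₁) + Λ' * (g₀₄ + Λ * g₅₄)| ≤ e' * |g₀₄ + Λ * g₅₄| := by
      have d01' : A * |(g₀₁ + Λ * g₅₁) + Λ' * (g₀₄ + Λ * g₅₄)| ≤ μ := by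
        have : (g₀₁ + Λ * g₅₁) + Λ' * (g₀₄ + Λ * g₅₄) = g₀₁ + Λ' * g₀₄ + Λ * g₅₁ + Λ * Λ' * g₅₄ := by ring
        rw [this]; exact d01
      have := strip_weight hκ.le hA d01' (by linarith [al] : κ * μ ≤ A * (e' * |g₀₄ + Λ * g₅₄|))
      exact this
    have hv54 : κ * (e * |g₅₄|) ≤ |g₀₄ + Λ * g₅₄| := by
      have d54' : (A * e') * (e * |g₅₄|) ≤ μ := by linarith [d54]
      exact strip_weight hκ.le (mul_pos hA he') d54' (by linarith [al])
    have hL := mixThree_core_same hκ₁ hκ hμ₁ he h04 b01 hv01 hv54 gΛ'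
    have hΛΦ : |Λ| ≤ Φ := by linarith [abs_nonneg Λ', inv_pos.mpr he, inv_pos.mpr he']
    have heΦ : e⁻¹ ≤ Φ := by linarith [abs_nonneg Λ, abs_nonneg Λ', inv_pos.mpr he']
    have heΦ' : e ≤ Φ := by linarith [abs_nonneg Λ, abs_nonneg Λ', inv_pos.mpr he, inv_pos.mpr he']
    have hΦ1' : 1 ≤ Φ := by linarith [abs_nonneg Λ, abs_nonneg Λ', inv_pos.mpr he, inv_pos.mpr he']
    exact mixThree_kill_same hκ₁ hκ hκ1 hκ₃ hμ₁ he hΛΦ heΦ heΦ' hΦ1' hL hD ks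
  rcases al₂ with a2 | a2
  · exact same hκ₂ hκ₂1 hA₂ he₂ he₂' a2 d01₂ d54₂ hΦ₂ gΛ₂' ks₂
  rcases al₃ with a3 | a3
  · exact same hκ₃ hκ₃1 hA₃ he₃ he₃' a3 d01₃ d54₃ hΦ₃ gΛ₃' ks₃
  -- (5,1) alive at both later scales
  have strip51 : ∀ {κ μ A e e' Λ Λ' : ℝ}, 0 < κ → 0 < A → 0 < e → 0 < e' →
      κ * μ ≤ A * e * |g₅₁ + Λ' * g₅₄| → A * |g₀₁ + Λ' * g₀₄ + Λ * g₅₁ + Λ * Λ' * g₅₄| ≤ μ → A * e' * |g₀₄ + Λ * g₅₄| ≤ μ →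
      A * (e * e') * |g₅₄| ≤ μ →
      κ * |(g₀₁ + Λ' * g₀₄) + Λ * (g₅₁ + Λ' * g₅₄)| ≤ e * |g₅₁ + Λ' * g₅₄| ∧ κ * (e' * |g₅₄|) ≤ |g₅₁ + Λ' * g₅₄| ∧
        κ * (e' * |g₀₄ + Λ * g₅₄|) ≤ e * |g₅₁ + Λ' * g₅₄| := by
    intro κ μ A e e' Λ Λ' hκ hA he he' al d01 d04 d54
    refine ⟨?_, ?_, ?_⟩
    · have d01' : A * |(g₀₁ + Λ' * g₀₄) + Λ * (g₅₁ + Λ' * g₅₄)| ≤ μ := by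
        have : (g₀₁ + Λ' * g₀₄) + Λ * (g₅₁ + Λ' * g₅₄) = g₀₁ + Λ' * g₀₄ + Λ * g₅₁ + Λ * Λ' * g₅₄ := by ring
        rw [this]; exact d01
      exact strip_weight hκ.le hA d01' (by linarith [al])
    · have d54' : (A * e) * (e' * |g₅₄|) ≤ μ := by linarith [d54]
      exact strip_weight hκ.le (mul_pos hA he) d54' (by linarith [al])
    · have d04' : A * (e' * |g₀₄ + Λ * g₅₄|) ≤ μ := by linarith [d04]
      exact strip_weight hκ.le hA d04' (by linarith [al])
  obtain ⟨v01₂, v54₂, v04₂⟩ := strip51 hκ₂ hA₂ he₂ he₂' a2 d01₂ d04₂ d54₂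
  obtain ⟨v01₃, v54₃, v04₃⟩ := strip51 hκ₃ hA₃ he₃ he₃' a3 d01₃ d04₃ d54₃
  have hX := mixThree_core_cross hκ₁ hκ₂ hκ₃ hμ₁ he₂ he₂' he₃ he₃' h04 v01₂ v54₂ v04₂ v01₃ v54₃ v04₃ hshift he₃L gΛL
  have hΛ₂Φ : |Λ₂| ≤ Φ := by linarith [abs_nonneg Λ₂']
  have hΛ₃Φ : |Λ₃| ≤ Φ := by linarith [abs_nonneg Λ₃']
  have hΛ₂'Φ : |Λ₂'| ≤ Φ := by linarith
  have hΛ₃'Φ : |Λ₃'| ≤ Φ := by linarith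
  exact mixThree_kill_cross hκ₁ hκ₂ hκ₃ hμ₁ he₂ he₂' he₃ he₃' hΦ1 hΛ₂Φ hΛ₃Φ hΛ₂'Φ hΛ₃'Φ (by linarith) (by linarith)
    (by linarith) (by linarith) (by linarith) hX hD kc

/-- **THE REPAIRED THREE-SCALE RULE, SCALAR FORM** (both first-scale cases).  Case `(5,1)` is case A under the relabelling
`0 ↔ 1`, `5 ↔ 4` (`g₀₄ ↔ g₅₁`, `Λ ↔ Λ'`, `e ↔ e'`; `D ↦ D`). [this work] -/
theorem mixThree_scalar {κ₁ κ₂ κ₃ μ₁ μ₂ μ₃ A₂ A₃ e₂ e₂' e₃ e₃' eL eL' Λ₂ Λ₂' Λ₃ Λ₃' ΛL ΛL' g₀₁ g₀₄ g₅₁ g₅₄ Φ ε : ℝ}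
    (hκ₁ : 0 < κ₁) (hκ₂ : 0 < κ₂) (hκ₃ : 0 < κ₃) (hκ₂1 : κ₂ ≤ 1) (hκ₃1 : κ₃ ≤ 1) (hμ₁ : 0 < μ₁)
    (hA₂ : 0 < A₂) (hA₃ : 0 < A₃) (he₂ : 0 < e₂) (he₂' : 0 < e₂') (he₃ : 0 < e₃) (he₃' : 0 < e₃') (hε : 0 < ε)
    (hal₁ : κ₁ * μ₁ ≤ |g₀₄| ∨ κ₁ * μ₁ ≤ |g₅₁|) (b01 : |g₀₁| ≤ μ₁)
    (al₂ : κ₂ * μ₂ ≤ A₂ * e₂' * |g₀₄ + Λ₂ * g₅₄| ∨ κ₂ * μ₂ ≤ A₂ * e₂ * |g₅₁ + Λ₂' * g₅₄|)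
    (d01₂ : A₂ * |g₀₁ + Λ₂' * g₀₄ + Λ₂ * g₅₁ + Λ₂ * Λ₂' * g₅₄| ≤ μ₂) (d04₂ : A₂ * e₂' * |g₀₄ + Λ₂ * g₅₄| ≤ μ₂)
    (d51₂ : A₂ * e₂ * |g₅₁ + Λ₂' * g₅₄| ≤ μ₂) (d54₂ : A₂ * (e₂ * e₂') * |g₅₄| ≤ μ₂)
    (al₃ : κ₃ * μ₃ ≤ A₃ * e₃' * |g₀₄ + Λ₃ * g₅₄| ∨ κ₃ * μ₃ ≤ A₃ * e₃ * |g₅₁ + Λ₃' * g₅₄|)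
    (d01₃ : A₃ * |g₀₁ + Λ₃' * g₀₄ + Λ₃ * g₅₁ + Λ₃ * Λ₃' * g₅₄| ≤ μ₃) (d04₃ : A₃ * e₃' * |g₀₄ + Λ₃ * g₅₄| ≤ μ₃)
    (d51₃ : A₃ * e₃ * |g₅₁ + Λ₃' * g₅₄| ≤ μ₃) (d54₃ : A₃ * (e₃ * e₃') * |g₅₄| ≤ μ₃)
    (hD : κ₃ * (g₀₁ * g₅₄ - g₀₄ * g₅₁) ^ 2 ≤ 240 * Φ ^ 6 * ε * μ₁ ^ 4)
    (hΦ₂ : 1 + |Λ₂| + |Λ₂'| + e₂ + e₂' + e₂⁻¹ + e₂'⁻¹ ≤ Φ) (hΦ₃ : 1 + |Λ₃| + |Λ₃'| + e₃ + e₃' + e₃⁻¹ + e₃'⁻¹ ≤ Φ)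
    (gΛ₂ : 1 / κ₂ * e₂ + (1 / κ₁ + 1) < |Λ₂|) (gΛ₃ : 1 / κ₃ * e₃ + (1 / κ₁ + 1) < |Λ₃|)
    (gΛ₂' : 1 / κ₂ * e₂' + (1 / κ₁ + 1) < |Λ₂'|) (gΛ₃' : 1 / κ₃ * e₃' + (1 / κ₁ + 1) < |Λ₃'|)
    (hshift : Λ₃ - Λ₂ = e₂ * ΛL) (he₃L : e₃ = e₂ * eL) (gΛL : 1 / κ₃ * eL + (1 / κ₂ + 1) < |ΛL|)
    (hshift' : Λ₃' - Λ₂' = e₂' * ΛL') (he₃L' : e₃' = e₂' * eL') (gΛL' : 1 / κ₃ * eL' + (1 / κ₂ + 1) < |ΛL'|)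
    (hkill : 122880 * Φ ^ 18 * ε < κ₁ ^ 4 * κ₂ ^ 2 * κ₃ ^ 3) : False := by
  rcases hal₁ with h04 | h51
  · exact mixThree_caseA hκ₁ hκ₂ hκ₃ hκ₂1 hκ₃1 hμ₁ hA₂ hA₃ he₂ he₂' he₃ he₃' hε h04 b01 al₂ d01₂ d04₂ d54₂ al₃ d01₃ d04₃ d54₃
      hD hΦ₂ hΦ₃ gΛ₂' gΛ₃' hshift he₃L gΛL hkill
  · -- relabel: `(0,4) ↔ (5,1)`, `Λ ↔ Λ'`, `e ↔ e'`
    have r01 : ∀ (Λ Λ' : ℝ), g₀₁ + Λ' * g₀₄ + Λ * g₅₁ + Λ * Λ' * g₅₄ = g₀₁ + Λ * g₅₁ + Λ' * g₀₄ + Λ' * Λ * g₅₄ := by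
      intro Λ Λ'; ring
    have hD' : κ₃ * (g₀₁ * g₅₄ - g₅₁ * g₀₄) ^ 2 ≤ 240 * Φ ^ 6 * ε * μ₁ ^ 4 := by rw [mul_comm g₅₁ g₀₄]; exact hD
    refine mixThree_caseA (g₀₄ := g₅₁) (g₅₁ := g₀₄) hκ₁ hκ₂ hκ₃ hκ₂1 hκ₃1 hμ₁ hA₂ hA₃ he₂' he₂ he₃' he₃ hε h51 b01 al₂.symm
      (by rw [← r01]; exact d01₂) d51₂ (by rw [mul_comm e₂' e₂]; exact d54₂) al₃.symm (by rw [← r01]; exact d01₃) d51₃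
      (by rw [mul_comm e₃' e₃]; exact d54₃) hD' (by linarith) (by linarith) gΛ₂ gΛ₃ hshift' he₃L' gΛL' hkill

end Summit.ValiantsHypothesis.ValiantsHypothesis.Theorems.LacunarySymmetroidMatrixDescartes.WallBubbling
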